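import Summits.RiemannHypothesis.RiemannHypothesis.Theorems.LiTailLaguerreFejerHit
import HarnessLib

/-!
# RiemannHypothesis / LiTailLaguerre — Fejér companion, part 8: the DISCRETE LIOUVILLE–GREEN BOOTSTRAP and the
# STRONG Fejér law `LiCoffeyTermFejer` (RH-FREE)

RH-FREE [rh-li-eng g6].  Cell `pub/rh-li`, PART K `Theorems/LiTailLaguerreDefs.lean`.  THE LAST OPEN COMPANION OF PART K
IS A THEOREM: `liCoffeyTermFejer_holds : LiCoffeyTermFejer` — for every `m ≥ 2` there is `C` with
`|liCoffeyTerm m n + liPrimeEcho m n| ≤ C n^{−1/4}` for all `n ≥ 1` (Fejér 1909 / Perron 1921 / Szegő Thm 8.22.1 for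
`α = 1`: `L¹_{n−1}(y) = π^{−1/2} e^{y/2} y^{−3/4} n^{1/4} cos(2√(ny) − 3π/4) + O(n^{−1/4})`).

METHOD (new here; no second-order stationary phase): let `u_n = liLaguerreOne n y`, `z_n = n^{1/4} e^{iφ_n}`
(`φ_n = 2√(ny) + π/4`), `c = e^{y/2} π^{−1/2} y^{−3/4}`, `E_n = u_n + c Re z_n`.  (1) WEAK LAW: `|E_n| ≤ K` for
`n ≥ N₀` (`Fejer.weak_bound`, from `Fejer.bridge_asymptotic`).  (2) `u` satisfies `u_{n+1} + u_{n−1} = (2 − y/n) u_n`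
exactly (`Fejer.liLaguerreOne_rec`) and `z` up to `r_n`, `‖r_n‖ ≤ 2(1+y+y²) n^{−7/4}` (`Fejer.norm_res_le`).  (3) The
quasi-Casoratian `Z_n = E_n z_{n+1} − E_{n+1} z_n` has increments `Z_n − Z_{n−1} = E_n r_n − c z_n Re r_n`, of size
`≤ A n^{−3/2}`, so `‖Z_p − Z_n‖ ≤ 2A/√n` for `p ≥ n`.  (4) `Im(z̄_p Z_p) = E_p · Im(z̄_p z_{p+1})` with
`Im(z̄_p z_{p+1}) ∈ [√y/2, 2√y]` (`Fejer.im_conj_zm_mul_bounds`), so `|Im(z̄_p Z_p)| ≤ 2K√y`; and since the phases `φ_p`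
increase to `∞` by steps `≤ 1/2` (`Fejer.exists_hit`), for every `n` there are arbitrarily large `p` with
`Im(z̄_p Z_n) ≥ p^{1/4}‖Z_n‖/2`, whence `p^{1/4}‖Z_n‖/2 ≤ 2K√y + p^{1/4}·2A/√n`, i.e. `‖Z_n‖ ≤ 4A/√n` (`p → ∞`).
(5) `|E_n|·√y/2 ≤ |Im(z̄_n Z_n)| ≤ n^{1/4}‖Z_n‖ ≤ 4A n^{−1/4}`.  Nothing here bears on the truth of RH.
-/

noncomputable section

-- D-0017: `Summit.<S>.<S>.…` is the designed namespace of a single-problem summit.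
set_option linter.dupNamespace false

open Complex MeasureTheory Set
open scoped ArithmeticFunction.vonMangoldt ComplexConjugate

namespace Summit.RiemannHypothesis.RiemannHypothesis.Theorems.LiTheory

namespace Fejer

/-! ### The bootstrap -/

set_option maxHeartbeats 1600000 in -- long but search-free bookkeeping
/-- **The discrete Liouville–Green bootstrap**: weak law + exact recurrence ⇒ `E_n = O(n^{−1/4})`.  For `y > 0`
there are `N`, `C` with `|liLaguerreOne n y + c Re z_n| ≤ C/n^{1/4}` for all `n ≥ N` (`c = e^{y/2} π^{−1/2} y^{−3/4}`). -/
theorem strong_bound {y : ℝ} (hy : 0 < y) :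
    ∃ N : ℕ, ∃ C : ℝ, ∀ n : ℕ, N ≤ n →
      |liLaguerreOne n y + Real.exp (y / 2) / Real.sqrt Real.pi * y ^ (-(3 / 4 : ℝ)) * (zm y n).re| ≤ C / qrt n := by
  -- constants
  obtain ⟨c, hc⟩ : ∃ c : ℝ, c = Real.exp (y / 2) / Real.sqrt Real.pi * y ^ (-(3 / 4 : ℝ)) := ⟨_, rfl⟩
  have hc0 : 0 ≤ c := by rw [hc]; positivity
  obtain ⟨K, hK⟩ : ∃ K : ℝ, K = Real.exp (y / 2) * (2 + 4 * 10 ^ 9 / y + 2 * Real.sqrt y + 1 / Real.sqrt y) / Real.pi :=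
    ⟨_, rfl⟩
  have hK0 : 0 ≤ K := by rw [hK]; positivity
  obtain ⟨A, hA⟩ : ∃ A : ℝ, A = 2 * (1 + y + y ^ 2) * (K + c) := ⟨_, rfl⟩
  have hA0 : 0 ≤ A := by rw [hA]; positivity
  obtain ⟨N, hN⟩ : ∃ N : ℕ, N = ⌈2 * y⌉₊ + ⌈4 / y⌉₊ + ⌈4 * y⌉₊ + 2 := ⟨_, rfl⟩
  -- the error sequence
  obtain ⟨E, hE⟩ : ∃ E : ℕ → ℝ, E = fun n ↦ liLaguerreOne n y + c * (zm y n).re := ⟨_, rfl⟩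
  have hEn : ∀ n, E n = liLaguerreOne n y + c * (zm y n).re := fun n ↦ by rw [hE]
  have hNfacts : ∀ n : ℕ, N ≤ n → 2 ≤ n ∧ (2 * y ≤ n ∧ 4 / y ≤ n) ∧ 4 * y ≤ n ∧ 1 ≤ n := by
    intro n hn
    have hnR : (N : ℝ) ≤ n := by exact_mod_cast hn
    rw [hN] at hnR; push_cast at hnR
    have hn2 : 2 ≤ n := by rw [hN] at hn; omega
    refine ⟨hn2, ⟨?_, ?_⟩, ?_, by omega⟩
    · linarith [Nat.le_ceil (2 * y)]
    · linarith [Nat.le_ceil (4 / y)]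
    · linarith [Nat.le_ceil (4 * y)]
  have hEK : ∀ n : ℕ, N ≤ n → |E n| ≤ K := by
    intro n hn
    obtain ⟨_, ⟨h2, h3⟩, _, h5⟩ := hNfacts n hn
    have := weak_bound hy h2 h3 h5
    rw [hEn, hK, hc, mul_assoc]
    simpa only [mul_assoc] using this
  -- the exact recurrence `u_{m+2} + u_m = (2 − y/(m+1)) u_{m+1}` (`m ≥ 1`)
  have hrec : ∀ m : ℕ, 1 ≤ m →
      liLaguerreOne (m + 2) y + liLaguerreOne m y = (2 - y / ((m : ℝ) + 1)) * liLaguerreOne (m + 1) y := by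
    intro m hm
    obtain ⟨j, rfl⟩ : ∃ j, m = j + 1 := ⟨m - 1, by omega⟩
    have := liLaguerreOne_rec y j
    push_cast
    rw [show j + 1 + 2 = j + 3 from rfl, show j + 1 + 1 = j + 2 from rfl,
      show (j : ℝ) + 1 + 1 = j + 2 by ring]
    exact this
  -- the quasi-Casoratian
  obtain ⟨Z, hZ⟩ : ∃ Z : ℕ → ℂ, Z = fun n ↦ (E n : ℂ) * zm y (n + 1) - (E (n + 1) : ℂ) * zm y n := ⟨_, rfl⟩
  have hZn : ∀ n, Z n = (E n : ℂ) * zm y (n + 1) - (E (n + 1) : ℂ) * zm y n := fun n ↦ by rw [hZ]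
  -- its increments
  have hinc : ∀ m : ℕ, N ≤ m → ‖Z (m + 1) - Z m‖ ≤ A * (Real.sqrt ((m : ℝ) + 1) / ((m : ℝ) + 1) ^ 2) := by
    intro m hm
    obtain ⟨hm2, _, hm4, _⟩ := hNfacts m hm
    -- the residual at the centre `m + 1`
    obtain ⟨r, hr⟩ : ∃ r : ℂ, r = zm y (m + 2) + zm y m - (2 - (y : ℂ) / ((m + 1 : ℕ) : ℂ)) * zm y (m + 1) := ⟨_, rfl⟩
    have hres : ‖r‖ ≤ 2 * (1 + y + y ^ 2) * qrt ((m + 1 : ℕ) : ℝ) / ((m + 1 : ℕ) : ℝ) ^ 2 := by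
      have := norm_res_le hy (n := m + 1) (by omega) (by push_cast; linarith)
      rw [show m + 1 + 1 = m + 2 from rfl, show m + 1 - 1 = m from rfl] at this
      rw [hr]; exact this
    -- the increment identity
    have hzre : (zm y (m + 2)).re + (zm y m).re = (2 - y / ((m : ℝ) + 1)) * (zm y (m + 1)).re + r.re := by
      have e : zm y (m + 2) + zm y m = (2 - (y : ℂ) / ((m + 1 : ℕ) : ℂ)) * zm y (m + 1) + r := by
        rw [hr]; ring
      have := congrArg Complex.re e
      rw [Complex.add_re, Complex.add_re, Complex.mul_re] at this
      have hre2 : (2 - (y : ℂ) / ((m + 1 : ℕ) : ℂ)).re = 2 - y / ((m : ℝ) + 1) := by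
        rw [show (2 - (y : ℂ) / ((m + 1 : ℕ) : ℂ)) = ((2 - y / ((m : ℝ) + 1) : ℝ) : ℂ) by push_cast; ring,
          Complex.ofReal_re]
      have him2 : (2 - (y : ℂ) / ((m + 1 : ℕ) : ℂ)).im = 0 := by
        rw [show (2 - (y : ℂ) / ((m + 1 : ℕ) : ℂ)) = ((2 - y / ((m : ℝ) + 1) : ℝ) : ℂ) by push_cast; ring,
          Complex.ofReal_im]
      rw [hre2, him2, zero_mul, sub_zero] at this
      exact this
    have hEsum : E (m + 2) + E m = (2 - y / ((m : ℝ) + 1)) * E (m + 1) + c * r.re := by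
      rw [hEn, hEn, hEn]
      linear_combination (hrec m (by omega)) + c * hzre
    have hid : Z (m + 1) - Z m = (E (m + 1) : ℂ) * r - (c : ℂ) * zm y (m + 1) * (r.re : ℂ) := by
      rw [hZn, hZn, show m + 1 + 1 = m + 2 from rfl]
      have hz : zm y (m + 2) = r - zm y m + (2 - (y : ℂ) / ((m + 1 : ℕ) : ℂ)) * zm y (m + 1) := by
        rw [hr]; ring
      have hEsumC : (E (m + 2) : ℂ) = (((2 - y / ((m : ℝ) + 1)) * E (m + 1) + c * r.re - E m : ℝ) : ℂ) := by
        rw [← hEsum]; push_cast; ring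
      rw [hz, hEsumC]
      push_cast
      ring
    rw [hid]
    have hE1 := hEK (m + 1) (by omega)
    have hq1 : 1 ≤ qrt ((m + 1 : ℕ) : ℝ) := one_le_qrt (by push_cast; linarith)
    have hrre : |r.re| ≤ ‖r‖ := Complex.abs_re_le_norm r
    have hm1 : ((m + 1 : ℕ) : ℝ) = (m : ℝ) + 1 := by push_cast; ring
    have hqq : qrt ((m + 1 : ℕ) : ℝ) * qrt ((m + 1 : ℕ) : ℝ) = Real.sqrt ((m : ℝ) + 1) := by
      rw [← sq, qrt_sq, hm1]
    calc ‖(E (m + 1) : ℂ) * r - (c : ℂ) * zm y (m + 1) * (r.re : ℂ)‖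
        ≤ ‖(E (m + 1) : ℂ) * r‖ + ‖(c : ℂ) * zm y (m + 1) * (r.re : ℂ)‖ := norm_sub_le _ _
      _ = |E (m + 1)| * ‖r‖ + c * qrt ((m + 1 : ℕ) : ℝ) * |r.re| := by
          rw [norm_mul, norm_mul, norm_mul, Complex.norm_real, Complex.norm_real, Complex.norm_real, norm_zm,
            Real.norm_eq_abs, Real.norm_eq_abs, Real.norm_eq_abs, abs_of_nonneg hc0]
      _ ≤ K * ‖r‖ + c * qrt ((m + 1 : ℕ) : ℝ) * ‖r‖ := by gcongr
      _ ≤ K * qrt ((m + 1 : ℕ) : ℝ) * ‖r‖ + c * qrt ((m + 1 : ℕ) : ℝ) * ‖r‖ := by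
          have : K * ‖r‖ * 1 ≤ K * ‖r‖ * qrt ((m + 1 : ℕ) : ℝ) :=
            mul_le_mul_of_nonneg_left hq1 (mul_nonneg hK0 (norm_nonneg r))
          linarith
      _ = (K + c) * qrt ((m + 1 : ℕ) : ℝ) * ‖r‖ := by ring
      _ ≤ (K + c) * qrt ((m + 1 : ℕ) : ℝ) * (2 * (1 + y + y ^ 2) * qrt ((m + 1 : ℕ) : ℝ) / ((m + 1 : ℕ) : ℝ) ^ 2) :=
          mul_le_mul_of_nonneg_left hres (by positivity)
      _ = A * (Real.sqrt ((m : ℝ) + 1) / ((m : ℝ) + 1) ^ 2) := by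
          rw [hA, ← hqq, hm1]; ring
  -- telescoping: `‖Z p − Z n‖ ≤ 2A(1/√n − 1/√p)` for `N ≤ n ≤ p`
  have htel : ∀ n : ℕ, N ≤ n → ∀ p : ℕ, n ≤ p →
      ‖Z p - Z n‖ ≤ 2 * A * (1 / Real.sqrt n - 1 / Real.sqrt p) := by
    intro n hn p hp
    induction p, hp using Nat.le_induction with
    | base => simp
    | succ p hp ih =>
      have hstep := hinc p (hn.trans hp)
      have hmaj := sqrt_div_sq_le p (by have := (hNfacts n hn).1; omega)
      have hmaj' := mul_le_mul_of_nonneg_left hmaj hA0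
      calc ‖Z (p + 1) - Z n‖ ≤ ‖Z (p + 1) - Z p‖ + ‖Z p - Z n‖ := norm_sub_le_norm_sub_add_norm_sub _ _ _
        _ ≤ A * (Real.sqrt ((p : ℝ) + 1) / ((p : ℝ) + 1) ^ 2) + 2 * A * (1 / Real.sqrt n - 1 / Real.sqrt p) :=
            add_le_add hstep ih
        _ ≤ A * (2 * (1 / Real.sqrt p - 1 / Real.sqrt ((p : ℝ) + 1)))
              + 2 * A * (1 / Real.sqrt n - 1 / Real.sqrt p) := by linarith
        _ = 2 * A * (1 / Real.sqrt n - 1 / Real.sqrt ((p + 1 : ℕ) : ℝ)) := by push_cast; ring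
  -- the Casoratian identity `Im(z̄_p Z_p) = E_p Im(z̄_p z_{p+1})`
  have hcas : ∀ p : ℕ, (conj (zm y p) * Z p).im = E p * (conj (zm y p) * zm y (p + 1)).im := by
    intro p
    rw [hZn]
    have e : conj (zm y p) * ((E p : ℂ) * zm y (p + 1) - (E (p + 1) : ℂ) * zm y p)
        = (E p : ℂ) * (conj (zm y p) * zm y (p + 1)) - (E (p + 1) : ℂ) * (conj (zm y p) * zm y p) := by ring
    rw [e, Complex.sub_im, Complex.im_ofReal_mul, Complex.im_ofReal_mul, Complex.conj_mul', ← Complex.ofReal_pow,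
      Complex.ofReal_im, mul_zero, sub_zero]
  -- the bound on `Z n`
  have hZb : ∀ n : ℕ, N ≤ n → ‖Z n‖ ≤ 4 * A / Real.sqrt n := by
    intro n hn
    obtain ⟨hn2, _, hn4, hn1⟩ := hNfacts n hn
    have hn0 : (0 : ℝ) < n := by exact_mod_cast (show 0 < n by omega)
    refine le_of_forall_pos_le_add fun ε hε ↦ ?_
    -- a threshold beyond which `4K√y/qrt p ≤ ε`
    obtain ⟨T₀, hT₀⟩ := exists_nat_ge (((4 * K * Real.sqrt y + 1) / ε) ^ 4)
    obtain ⟨p, hpT, hsin⟩ := exists_hit hy (Complex.arg (Z n)) (T := max n T₀) (hn2.trans (le_max_left _ _))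
      (hn4.trans (by exact_mod_cast le_max_left n T₀))
    have hpn : n ≤ p := (le_max_left _ _).trans hpT
    have hpN : N ≤ p := hn.trans hpn
    obtain ⟨hp2, _, hp4, _⟩ := hNfacts p hpN
    have hp0 : (0 : ℝ) < p := by exact_mod_cast (show 0 < p by omega)
    have hqp : 0 < qrt p := qrt_pos hp0
    -- `qrt p ≥ (4K√y + 1)/ε`
    have hqT : (4 * K * Real.sqrt y + 1) / ε ≤ qrt p := by
      have hp' : ((4 * K * Real.sqrt y + 1) / ε) ^ 4 ≤ p := by
        calc ((4 * K * Real.sqrt y + 1) / ε) ^ 4 ≤ T₀ := hT₀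
          _ ≤ p := by exact_mod_cast (le_max_right _ _).trans hpT
      exact (qrt_bounds (by positivity) (qrt_nonneg _) hp0.le hp' (le_of_eq (qrt_pow_four hp0.le).symm)).1
    -- `Im(z̄_p Z_n) ≥ qrt p ‖Z n‖ / 2`
    have hmain : qrt p * ‖Z n‖ * (1 / 2) ≤ (conj (zm y p) * Z n).im := by
      have hpolar : Z n = (‖Z n‖ : ℂ) * cexp ((Complex.arg (Z n) : ℂ) * I) :=
        (Complex.norm_mul_exp_arg_mul_I (Z n)).symm
      have e : conj (zm y p) * Z n
          = ((qrt p * ‖Z n‖ : ℝ) : ℂ) * cexp (((Complex.arg (Z n) - phi y p : ℝ) : ℂ) * I) := by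
        conv_lhs => rw [hpolar]
        unfold zm
        rw [map_mul, Complex.conj_ofReal, ← Complex.exp_conj, map_mul, Complex.conj_I, Complex.conj_ofReal,
          mul_mul_mul_comm, ← Complex.exp_add]
        push_cast
        ring_nf
      rw [e, Complex.im_ofReal_mul, Complex.exp_ofReal_mul_I_im]
      exact mul_le_mul_of_nonneg_left hsin (by positivity)
    -- `Im(z̄_p Z_n) ≤ |E p| Δ_p + qrt p ‖Z n − Z p‖`
    have hsplit : (conj (zm y p) * Z n).im ≤ 2 * K * Real.sqrt y + qrt p * (2 * A / Real.sqrt n) := by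
      have e : conj (zm y p) * Z n = conj (zm y p) * Z p + conj (zm y p) * (Z n - Z p) := by ring
      rw [e, Complex.add_im, hcas p]
      obtain ⟨hΔ1, hΔ2⟩ := im_conj_zm_mul_bounds hy hp2 hp4
      have hΔ0 : 0 ≤ (conj (zm y p) * zm y (p + 1)).im := by linarith [Real.sqrt_nonneg y]
      have t1 : E p * (conj (zm y p) * zm y (p + 1)).im ≤ 2 * K * Real.sqrt y := by
        calc E p * (conj (zm y p) * zm y (p + 1)).im ≤ |E p| * (conj (zm y p) * zm y (p + 1)).im :=
              mul_le_mul_of_nonneg_right (le_abs_self _) hΔ0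
          _ ≤ K * (2 * Real.sqrt y) := mul_le_mul (hEK p hpN) hΔ2 hΔ0 hK0
          _ = 2 * K * Real.sqrt y := by ring
      have t2 : (conj (zm y p) * (Z n - Z p)).im ≤ qrt p * (2 * A / Real.sqrt n) := by
        have hsp : 0 ≤ 1 / Real.sqrt (p : ℝ) := by positivity
        calc (conj (zm y p) * (Z n - Z p)).im ≤ ‖conj (zm y p) * (Z n - Z p)‖ := Complex.im_le_norm _
          _ = qrt p * ‖Z p - Z n‖ := by rw [norm_mul, Complex.norm_conj, norm_zm, norm_sub_rev]
          _ ≤ qrt p * (2 * A * (1 / Real.sqrt n - 1 / Real.sqrt p)) :=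
              mul_le_mul_of_nonneg_left (htel n hn p hpn) hqp.le
          _ ≤ qrt p * (2 * A / Real.sqrt n) := by
              apply mul_le_mul_of_nonneg_left _ hqp.le
              have : 2 * A * (1 / Real.sqrt n - 1 / Real.sqrt p) ≤ 2 * A * (1 / Real.sqrt n) :=
                mul_le_mul_of_nonneg_left (by linarith) (by positivity)
              rw [mul_one_div] at this
              exact this
      linarith
    -- combine
    have h1 : qrt p * ‖Z n‖ ≤ 4 * K * Real.sqrt y + qrt p * (4 * A / Real.sqrt n) := by
      have := hmain.trans hsplit
      have e : qrt p * (4 * A / Real.sqrt n) = 2 * (qrt p * (2 * A / Real.sqrt n)) := by ring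
      linarith
    have h3 : 4 * K * Real.sqrt y ≤ qrt p * ε := by
      rw [div_le_iff₀ hε] at hqT
      nlinarith [Real.sqrt_nonneg y]
    have h4 : qrt p * ‖Z n‖ ≤ qrt p * (4 * A / Real.sqrt n + ε) := by nlinarith
    exact le_of_mul_le_mul_left h4 hqp
  -- conclusion
  refine ⟨N, 8 * A / Real.sqrt y, fun n hn ↦ ?_⟩
  obtain ⟨hn2, _, hn4, _⟩ := hNfacts n hn
  have hn0 : (0 : ℝ) < n := by exact_mod_cast (show 0 < n by omega)
  have hq : 0 < qrt n := qrt_pos hn0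
  have hsy : 0 < Real.sqrt y := Real.sqrt_pos.2 hy
  obtain ⟨hΔ1, _⟩ := im_conj_zm_mul_bounds hy hn2 hn4
  have hΔ0 : 0 ≤ (conj (zm y n) * zm y (n + 1)).im := by linarith [Real.sqrt_nonneg y]
  have h1 : |E n| * (Real.sqrt y / 2) ≤ qrt n * (4 * A / Real.sqrt n) := by
    calc |E n| * (Real.sqrt y / 2) ≤ |E n| * (conj (zm y n) * zm y (n + 1)).im :=
          mul_le_mul_of_nonneg_left hΔ1 (abs_nonneg _)
      _ = |(conj (zm y n) * Z n).im| := by rw [hcas n, abs_mul, abs_of_nonneg hΔ0]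
      _ ≤ ‖conj (zm y n) * Z n‖ := Complex.abs_im_le_norm _
      _ = qrt n * ‖Z n‖ := by rw [norm_mul, Complex.norm_conj, norm_zm]
      _ ≤ qrt n * (4 * A / Real.sqrt n) := mul_le_mul_of_nonneg_left (hZb n hn) hq.le
  have hsq : Real.sqrt n = qrt n * qrt n := by rw [← sq, qrt_sq]
  rw [hsq] at h1
  have e : qrt n * (4 * A / (qrt n * qrt n)) = 4 * A / qrt n := by field_simp
  rw [e] at h1
  have h2 : |E n| ≤ 8 * A / Real.sqrt y / qrt n := by
    rw [le_div_iff₀ hq, le_div_iff₀ hsy]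
    have := mul_le_mul_of_nonneg_right h1 hq.le
    rw [div_mul_cancel₀ _ hq.ne'] at this
    nlinarith
  rw [← hc, ← hEn]
  exact h2

end Fejer

/-! ### The strong Fejér law -/

/-- **PART K's companion `LiCoffeyTermFejer` holds (RH-FREE):** for every `m ≥ 2` there is `C` with
`|liCoffeyTerm m n + liPrimeEcho m n| ≤ C · n^{−1/4}` for all `n ≥ 1` — the Bombieri–Lagarias/Coffey term
`(Λ(m)/m) L¹_{n−1}(log m)` equals minus the echo `E_m(n)` up to `O_m(n^{−1/4})` (Fejér 1909 / Szegő Thm 8.22.1, `α = 1`),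
proved by the discrete Liouville–Green bootstrap `Fejer.strong_bound`. -/
theorem liCoffeyTermFejer_holds : LiCoffeyTermFejer := by
  intro m hm
  obtain ⟨y, hy⟩ : ∃ y : ℝ, y = Real.log m := ⟨_, rfl⟩
  have hy0 : 0 < y := by rw [hy]; exact Real.log_pos (by exact_mod_cast (show 1 < m by omega))
  have hm0 : (0 : ℝ) < m := by exact_mod_cast (show 0 < m by omega)
  obtain ⟨N, C, hC⟩ := Fejer.strong_bound hy0
  -- constants
  have hΛ : (0 : ℝ) ≤ Λ m := ArithmeticFunction.vonMangoldt_nonneg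
  have hk0 : 0 ≤ (Λ m : ℝ) / m := by positivity
  have hexp : Real.exp (y / 2) = Real.sqrt m := by
    rw [hy, Real.sqrt_eq_rpow, Real.rpow_def_of_pos hm0]; congr 1; ring
  -- the identity `liCoffeyTerm + liPrimeEcho = (Λ/m) · E_n`
  have hid : ∀ n : ℕ, 1 ≤ n → liCoffeyTerm m n + liPrimeEcho m n
      = (Λ m : ℝ) / m *
        (liLaguerreOne n y + Real.exp (y / 2) / Real.sqrt Real.pi * y ^ (-(3 / 4 : ℝ)) * (Fejer.zm y n).re) := by
    intro n hn
    have hn0 : (0 : ℝ) < n := by exact_mod_cast hn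
    rw [Fejer.zm_re, Fejer.qrt_eq_rpow hn0.le, hexp, liCoffeyTerm, liPrimeEcho]
    unfold Fejer.phi
    rw [← hy]
    have hsm : Real.sqrt m * Real.sqrt m = m := Real.mul_self_sqrt hm0.le
    have hsm0 : Real.sqrt m ≠ 0 := (Real.sqrt_pos.2 hm0).ne'
    have e1 : (Λ m : ℝ) / Real.sqrt m = (Λ m : ℝ) / m * Real.sqrt m := by
      rw [div_eq_iff hsm0, mul_assoc, hsm, div_mul_cancel₀ _ hm0.ne']
    rw [e1]
    ring
  -- absorb `n < N` into the constant
  have hC0 : 0 ≤ C := by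
    have h := hC (max N 1) (le_max_left _ _)
    have hq : 0 < Fejer.qrt ((max N 1 : ℕ) : ℝ) := Fejer.qrt_pos (by exact_mod_cast (show 0 < max N 1 by omega))
    have := (abs_nonneg _).trans h
    rw [le_div_iff₀ hq] at this
    nlinarith
  obtain ⟨S, hS⟩ : ∃ S : ℝ, S = ∑ j ∈ Finset.range (N + 1), |liCoffeyTerm m j + liPrimeEcho m j| := ⟨_, rfl⟩
  have hS0 : 0 ≤ S := by rw [hS]; exact Finset.sum_nonneg fun _ _ ↦ abs_nonneg _
  refine ⟨(Λ m : ℝ) / m * C + S * Fejer.qrt ((N : ℝ) + 1), fun n hn ↦ ?_⟩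
  have hn0 : (0 : ℝ) < n := by exact_mod_cast hn
  have hq : 0 < Fejer.qrt n := Fejer.qrt_pos hn0
  have hrpow : (n : ℝ) ^ (-(1 / 4 : ℝ)) = 1 / Fejer.qrt n := by
    rw [Real.rpow_neg hn0.le, ← Fejer.qrt_eq_rpow hn0.le, one_div]
  rw [hrpow]
  have hSq : 0 ≤ S * Fejer.qrt ((N : ℝ) + 1) := mul_nonneg hS0 (Fejer.qrt_nonneg _)
  rcases le_or_gt N n with hNn | hNn
  · rw [hid n hn, abs_mul, abs_of_nonneg hk0]
    calc (Λ m : ℝ) / m * |liLaguerreOne n y + Real.exp (y / 2) / Real.sqrt Real.pi * y ^ (-(3 / 4 : ℝ))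
            * (Fejer.zm y n).re|
        ≤ (Λ m : ℝ) / m * (C / Fejer.qrt n) := mul_le_mul_of_nonneg_left (hC n hNn) hk0
      _ = ((Λ m : ℝ) / m * C) * (1 / Fejer.qrt n) := by ring
      _ ≤ ((Λ m : ℝ) / m * C + S * Fejer.qrt ((N : ℝ) + 1)) * (1 / Fejer.qrt n) := by
          apply mul_le_mul_of_nonneg_right _ (by positivity); linarith
  · have hle : |liCoffeyTerm m n + liPrimeEcho m n| ≤ S := by
      rw [hS]
      exact Finset.single_le_sum (f := fun j ↦ |liCoffeyTerm m j + liPrimeEcho m j|) (fun _ _ ↦ abs_nonneg _)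
        (Finset.mem_range.2 (by omega))
    have hqN : Fejer.qrt n ≤ Fejer.qrt ((N : ℝ) + 1) := Fejer.qrt_le_qrt (by
      have : (n : ℝ) ≤ N := by exact_mod_cast hNn.le
      linarith)
    rw [mul_one_div, le_div_iff₀ hq]
    have h1 : S * Fejer.qrt n ≤ S * Fejer.qrt ((N : ℝ) + 1) := mul_le_mul_of_nonneg_left hqN hS0
    have h2 : |liCoffeyTerm m n + liPrimeEcho m n| * Fejer.qrt n ≤ S * Fejer.qrt n :=
      mul_le_mul_of_nonneg_right hle hq.le
    have h3 : 0 ≤ (Λ m : ℝ) / m * C := mul_nonneg hk0 hC0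
    linarith

end Summit.RiemannHypothesis.RiemannHypothesis.Theorems.LiTheory

end
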